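import Summits.CriticalPhenomena.PercolationContinuityZ3.Theorems.PercAnnulusCrossingIICRerootedPair
import Summits.CriticalPhenomena.PercolationContinuityZ3.Theorems.PercAnnulusCrossingIICManyPointsOneScaleCritical
import Summits.CriticalPhenomena.PercolationContinuityZ3.Theorems.PercAnnulusCrossingIICManyPointsOneScaleUpper
import Summits.CriticalPhenomena.PercolationContinuityZ3.Theorems.PercAnnulusCrossingIICCondFatPaleyZygmund
import HarnessLib

/-!
# The pair-connectivity formula of Kesten's IIC in all regimes: `ν(x, y ∈ C(0)) ≍ π(min(‖x‖,‖y‖))·π(‖x − y‖)` (lane RSW3, p1 gen 21)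

builds on p205010 (kernel theorem, internal audit signed; external expert review pending) — USED through `θ(p_c) = 0`
(gen 10's exact re-rooting at `p_c(ℤ^d)`, via gen 20's `iicMeasure_real_openConn_inter_openConn_eq_reroot`).

RSW3 lane (LANE 3 `prim-rsw3`), seat `prim-rsw3-p1` (gen 21).  Helper file (`--supports stmt-CriticalPhenomena-4575`);
no definitions, no sorries.  Memo `run/shared/lean/prim/rsw3/P1-QM.md` §34.

Gen 19 (12) (separated scales), gen 20 (1b)/(4) (one scale) and gen 20 (6) (a close pair far away) each cover one regime of the
pair-connectivity (three-point) function of Kesten's IIC, with a scale gap `ρ` between the regimes.  This file closes the gaps and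
states ONE formula for ALL pairs of sites: with `d₁ ≤ d₂ ≤ d₃` the three pairwise sup-distances of `{0, x, y}` (so `d₃ ≤ d₁ + d₂ ≤ 2d₂`),
**`ν(x, y ∈ C(0)) ≍ π(d₁)·π(d₂) ≍ π(min(‖x‖,‖y‖))·π(‖x − y‖)`** — the IIC three-point function is a TREE: the farther site hangs off
the nearer one at the price of one arm of length their distance.  The proof re-roots the IIC (exactly, `θ(p_c) = 0`) at the common vertex of
the two longest sides of the triangle `{0, x, y}`, after which both sites lie in ONE dyadic shell `[d₂, 2d₂]` at mutual distance `d₁ ≤ d₂`;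
there the near-pair theorem (`ρd₁ ≤ d₂`) or the one-scale theorems (`d₂ < ρd₁`, separation `2⌊d₁/4⌋`, ratio bounds `B^{O(ρ)}`) apply.

* **`exists_iicMeasure_real_pair_two_sided_frame_criticalProbI`** — the one-shell frame: for `‖u‖ ≤ ‖v‖ ≤ 2‖u‖` and `n₀ ≤ ‖v − u‖ ≤ ‖u‖`:
  **`c·π(‖u‖)·π(‖v − u‖) ≤ ν(u, v ∈ C(0)) ≤ C·π(‖u‖)·π(‖v − u‖)`** (no scale gap);
* **`exists_iicMeasure_real_pair_two_sided_criticalProbI`** — THE PAIR FORMULA: for all `x, y` with `‖x‖, ‖y‖, ‖x − y‖ ≥ n₀`: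
  **`c·π(min(‖x‖,‖y‖))·π(‖x − y‖) ≤ ν(x, y ∈ C(0)) ≤ C·π(min(‖x‖,‖y‖))·π(‖x − y‖)`**;
The symmetric form `ν(x, y ∈ C(0))·π(d₃) ≍ π(‖x‖)π(‖y‖)π(‖x − y‖)` and the conditional form `ν(x, y ∈ C(0)) ≍ π(‖y − x‖)·ν(0 ↔ x)`
(`‖x‖ ≤ ‖y‖`) are in `…IICPairFormulaCorollaries`.
All at `p_c(ℤ^d)`, `d ≥ 2`, under (A2)□(s,L) + `CU⁺_l` + UAD, for IIC probability measures `ν` (Kesten's limit property), constants uniform in `ν`.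
References: H. Kesten, Probab. Theory Relat. Fields 73 (1986) Thm. (8); A. Járai, Ann. Probab. 31 (2003) §3;
D. Basu, A. Sapozhnikov, ECP 22 (2017) Thm. 1.1, Remark 2.1.
-/

noncomputable section

namespace Summit.CriticalPhenomena.PercolationContinuityZ3.Theorems.Crossing

open MeasureTheory Filter Topology Literature.Probability.Percolation Literature.Probability.LatticeModels
open Literature.Probability.Percolation.DCT16
open Summit.CriticalPhenomena.PercolationContinuityZ3.Theorems.SurfaceTension

variable {d : ℕ}

/-- `7ρ ≤ 8^{ρ+1}`. [folklore] -/
theorem seven_mul_le_eight_pow_succ (ρ : ℕ) : 7 * ρ ≤ 8 ^ (ρ + 1) := by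
  induction ρ with
  | zero => norm_num
  | succ n ih =>
    have h1 : 1 ≤ 8 ^ (n + 1) := Nat.one_le_pow _ _ (by norm_num)
    rw [pow_succ]; omega

/-- **THE PAIR-CONNECTIVITY FUNCTION OF KESTEN'S IIC IN ONE SHELL, WITHOUT A SCALE GAP** (`p_c(ℤ^d)`, `d ≥ 2`; (A2)□ at aspect `(s,L)`,
`2 ≤ s ≤ L`, `ϰ > 0`; `CU⁺_l(c_U)`, `l ≥ 2`, `c_U > 0`; UAD; `θ(p_c) = 0` from p205010 enters through the near-pair theorem): there are
`n₀ ≥ 1` and `0 < c, C` such that for every IIC probability measure `ν` (Kesten's limit property) and all sites `u, v` with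
`‖u‖_∞ ≤ ‖v‖_∞ ≤ 2‖u‖_∞` and `n₀ ≤ ‖v − u‖_∞ ≤ ‖u‖_∞`:
**`c·π_{p_c}(‖u‖)·π_{p_c}(‖v − u‖) ≤ ν({0 ↔ u} ∩ {0 ↔ v}) ≤ C·π_{p_c}(‖u‖)·π_{p_c}(‖v − u‖)`**.
Proof: with `ρ` the scale gap of gen 20's near-pair theorem, either `ρ‖v − u‖ ≤ ‖u‖` (near pair) or `‖u‖ < ρ‖v − u‖`, and then both
sites lie in the shell `[‖u‖, 2‖u‖]` at mutual distance `> 2⌊‖v−u‖/4⌋` with `‖u‖ ≤ 8^{ρ+1}⌊‖v−u‖/4⌋`: the one-scale lower bound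
(`c_U(cπ(n))²`) and the one-scale upper bound at separation `2⌊‖v−u‖/4⌋` (`(B^{ρ+3}/c²)(B^{ρ+1}π(n))²`) apply, and `π(‖v−u‖) ≤ B^{ρ+1}π(‖u‖)`.
[cite: Kesten1986, Thm. (8)] [cite: BasuSapozhnikov2017ECP, Thm. 1.1 and Remark 2.1] -/
theorem exists_iicMeasure_real_pair_two_sided_frame_criticalProbI (hd : 2 ≤ d) {s L : ℕ} (hs : 2 ≤ s) (hsL : s ≤ L)
    {ϰ : ℝ} (hϰ : 0 < ϰ) (hA2 : SetToSetQuasiMultAspectAt d (criticalProbI d) s L ϰ) {l : ℕ} (hl : 2 ≤ l) {cU : ℝ} (hcU : 0 < cU)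
    (hCU : ∀ a : ℕ, 1 ≤ a → ∀ E : Set (BondConfig (Site d)), IsUpperSet E → MeasurableSet E →
      cU * (bondPercolation (zdGraph d) (criticalProbI d)).real E ≤ (bondPercolation (zdGraph d) (criticalProbI d)).real (E ∩
        {ω : BondConfig (Site d) | ∀ t ∈ innerBoundary (zdGraph d) (box d a), ∀ s ∈ innerBoundary (zdGraph d) (box d (l * a)),
          ∀ t' ∈ innerBoundary (zdGraph d) (box d a), ∀ s' ∈ innerBoundary (zdGraph d) (box d (l * a)),
          ω ∈ openConnIn (↑((box d (l * a) \ box d a) ∪ innerBoundary (zdGraph d) (box d a)) : Set (Site d)) t s →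
          ω ∈ openConnIn (↑((box d (l * a) \ box d a) ∪ innerBoundary (zdGraph d) (box d a)) : Set (Site d)) t' s' →
          ω ∈ openConnIn (↑((box d (l * a) \ box d a) ∪ innerBoundary (zdGraph d) (box d a)) : Set (Site d)) s s'}))
    (hUAD : ∀ ε : ℝ, 0 < ε → ∃ K₀ : ℕ, ∀ m : ℕ, 1 ≤ m → ∀ N : ℕ, K₀ * m ≤ N →
      (bondPercolation (zdGraph d) (criticalProbI d)).real (boxCrossing d m N) ≤ ε) :
    ∃ (n₀ : ℕ) (c C : ℝ), 1 ≤ n₀ ∧ 0 < c ∧ 0 < C ∧ ∀ (ν : Measure (BondConfig (Site d))) [IsProbabilityMeasure ν],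
      (∀ (F : Finset (Sym2 (Site d))) (E : Set (BondConfig (Site d))), MeasurableSet E → DeterminedBy E ↑F →
        Tendsto (fun n : ℕ => (bondPercolation (zdGraph d) (criticalProbI d)).real (E ∩ siteToBoundary d n) /
          oneArmProb d (criticalProbI d) n) atTop (𝓝 (ν.real E))) →
      ∀ u v : Site d, Site.supNorm u ≤ Site.supNorm v → Site.supNorm v ≤ 2 * Site.supNorm u →
        n₀ ≤ Site.supNorm (v - u) → Site.supNorm (v - u) ≤ Site.supNorm u →
        c * oneArmProb d (criticalProbI d) (Site.supNorm u) * oneArmProb d (criticalProbI d) (Site.supNorm (v - u)) ≤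
            ν.real ((openConn (0 : Site d) u : Set (BondConfig (Site d))) ∩ openConn (0 : Site d) v) ∧
          ν.real ((openConn (0 : Site d) u : Set (BondConfig (Site d))) ∩ openConn (0 : Site d) v) ≤
            C * oneArmProb d (criticalProbI d) (Site.supNorm u) * oneArmProb d (criticalProbI d) (Site.supNorm (v - u)) := by
  have hd1 : 1 ≤ d := le_trans (by norm_num) hd
  have hp : 0 < ((criticalProbI d : unitInterval) : ℝ) := by
    rw [coe_criticalProbI]; exact criticalProb_zd_pos d hd1
  have hπ : ∀ m : ℕ, 0 < oneArmProb d (criticalProbI d) m := fun m => oneArmProb_pos hd1 _ hp m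
  obtain ⟨ρ, n₁, c₁, C₁, hρ, hn₁, hc₁, hC₁, hnear⟩ :=
    exists_iicMeasure_real_pair_two_sided_near_criticalProbI hd hs hsL hϰ hA2 hl hcU hCU hUAD
  obtain ⟨n₂, c₂, hn₂, hc₂, hlow⟩ := exists_iicMeasure_real_biInter_openConn_ge_criticalProbI hd hs hsL hϰ hA2 hl hcU hCU hUAD
  obtain ⟨c, hc, hQM⟩ := oneArmQuasiMultAt_of_setToSetQuasiMultAspectAt hd hs hsL hϰ hA2
  obtain ⟨B, hB, hR⟩ := Rsw3.exists_oneArmProb_ratio_of_setToSetQuasiMultAspectAt hd hs hsL hϰ hA2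
  have hRk := oneArmProb_ratio_iter (criticalProbI d) hR hπ (ρ + 1)
  have h8 : 7 * ρ ≤ 8 ^ (ρ + 1) := seven_mul_le_eight_pow_succ ρ
  refine ⟨max n₁ (max n₂ 4), min c₁ (cU * c₂ ^ 2 / B ^ (ρ + 1)), max C₁ (B ^ (3 * (ρ + 1) + 2) / c ^ 2),
    le_trans hn₁ (le_max_left _ _), lt_min hc₁ (by positivity), lt_max_of_lt_left hC₁, fun ν _ hν u v huv hvu hm hmu => ?_⟩
  set n := Site.supNorm u with hn_def
  set m := Site.supNorm (v - u) with hm_def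
  have hm1 : n₁ ≤ m := le_trans (le_max_left _ _) hm
  have hm2 : n₂ ≤ m := le_trans ((le_max_left _ _).trans (le_max_right _ _)) hm
  have hm4 : 4 ≤ m := le_trans ((le_max_right _ _).trans (le_max_right _ _)) hm
  have hπn := hπ n
  have hπm := hπ m
  by_cases hcase : ρ * m ≤ n
  · -- a near pair: gen 20 (6)
    have h := hnear ν hν u v hm1 hcase
    constructor
    · calc min c₁ (cU * c₂ ^ 2 / B ^ (ρ + 1)) * oneArmProb d (criticalProbI d) n * oneArmProb d (criticalProbI d) m
          ≤ c₁ * oneArmProb d (criticalProbI d) n * oneArmProb d (criticalProbI d) m :=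
            mul_le_mul_of_nonneg_right (mul_le_mul_of_nonneg_right (min_le_left _ _) hπn.le) hπm.le
        _ ≤ _ := h.1
    · calc ν.real ((openConn (0 : Site d) u : Set (BondConfig (Site d))) ∩ openConn (0 : Site d) v)
          ≤ C₁ * oneArmProb d (criticalProbI d) n * oneArmProb d (criticalProbI d) m := h.2
        _ ≤ max C₁ (B ^ (3 * (ρ + 1) + 2) / c ^ 2) * oneArmProb d (criticalProbI d) n * oneArmProb d (criticalProbI d) m :=
            mul_le_mul_of_nonneg_right (mul_le_mul_of_nonneg_right (le_max_left _ _) hπn.le) hπm.le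
  · -- one shell, comparable distances: gen 20 (1b) and (4)
    have hlt : n < ρ * m := lt_of_not_ge hcase
    have huv_ne : u ≠ v := by
      intro h
      have : m = 0 := by rw [hm_def, h, sub_self]; exact Site.supNorm_eq_zero_iff.mpr rfl
      omega
    -- the ratio `π(m) ≤ B^{ρ+1} π(n)` (`m ≤ n ≤ 8^{ρ+1} m`)
    have hnm8 : n ≤ 8 ^ (ρ + 1) * m := by
      have h1 : ρ * m ≤ 8 ^ (ρ + 1) * m := Nat.mul_le_mul_right m (by omega)
      omega
    have hratio : oneArmProb d (criticalProbI d) m ≤ B ^ (ρ + 1) * oneArmProb d (criticalProbI d) n :=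
      hRk m n (by omega) hmu hnm8
    have hmono : oneArmProb d (criticalProbI d) n ≤ oneArmProb d (criticalProbI d) m :=
      real_siteToBoundary_antitone (criticalProbI d) hmu
    have hBk : 0 < B ^ (ρ + 1) := pow_pos hB _
    -- the pair as a two-element set in the shell `[n, 2n]`
    have hS : ∀ z ∈ ({u, v} : Finset (Site d)), n ≤ Site.supNorm z ∧ Site.supNorm z ≤ 2 * n := by
      intro z hz
      rcases Finset.mem_insert.mp hz with rfl | hz
      · exact ⟨le_rfl, by omega⟩
      · rw [Finset.mem_singleton] at hz; subst hz; exact ⟨huv, hvu⟩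
    have hset : (⋂ z ∈ ({u, v} : Finset (Site d)), (openConn (0 : Site d) z : Set (BondConfig (Site d)))) =
        (openConn (0 : Site d) u : Set (BondConfig (Site d))) ∩ openConn (0 : Site d) v := by
      rw [Finset.set_biInter_insert, Finset.set_biInter_singleton]
    have hcard : ({u, v} : Finset (Site d)).card = 2 := Finset.card_pair huv_ne
    constructor
    · -- lower bound
      have h := hlow ν hν n (le_trans hm2 hmu) {u, v} hS
      rw [hset, hcard, probReal_univ, mul_one] at h
      calc min c₁ (cU * c₂ ^ 2 / B ^ (ρ + 1)) * oneArmProb d (criticalProbI d) n * oneArmProb d (criticalProbI d) m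
          ≤ (cU * c₂ ^ 2 / B ^ (ρ + 1)) * oneArmProb d (criticalProbI d) n * (B ^ (ρ + 1) * oneArmProb d (criticalProbI d) n) := by
            have h0 : min c₁ (cU * c₂ ^ 2 / B ^ (ρ + 1)) ≤ cU * c₂ ^ 2 / B ^ (ρ + 1) := min_le_right _ _
            have h0' : 0 ≤ cU * c₂ ^ 2 / B ^ (ρ + 1) := by positivity
            calc _ ≤ (cU * c₂ ^ 2 / B ^ (ρ + 1)) * oneArmProb d (criticalProbI d) n * oneArmProb d (criticalProbI d) m :=
                  mul_le_mul_of_nonneg_right (mul_le_mul_of_nonneg_right h0 hπn.le) hπm.le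
              _ ≤ _ := mul_le_mul_of_nonneg_left hratio (mul_nonneg h0' hπn.le)
        _ = cU * (c₂ * oneArmProb d (criticalProbI d) n) ^ 2 := by
            field_simp
        _ ≤ _ := h
    · -- upper bound at separation `2⌊m/4⌋`
      have hr : 1 ≤ m / 4 := by omega
      have hrn : 4 * (m / 4) ≤ n := by omega
      have hnr : n ≤ 8 ^ (ρ + 1) * (m / 4) := by
        have h1 : ρ * m ≤ ρ * (7 * (m / 4)) := Nat.mul_le_mul_left ρ (by omega)
        have h3 : 7 * ρ * (m / 4) ≤ 8 ^ (ρ + 1) * (m / 4) := Nat.mul_le_mul_right _ h8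
        have h4 : ρ * (7 * (m / 4)) = 7 * ρ * (m / 4) := by ring
        omega
      have hsep : ∀ z ∈ ({u, v} : Finset (Site d)), ∀ z' ∈ ({u, v} : Finset (Site d)), z ≠ z' →
          z - z' ∉ box d (m / 4 + m / 4) := by
        have key : ∀ w : Site d, Site.supNorm w = m → w ∉ box d (m / 4 + m / 4) := by
          intro w hw hmem
          rw [mem_box_iff_supNorm_le, hw] at hmem
          omega
        intro z hz z' hz' hne
        simp only [Finset.mem_insert, Finset.mem_singleton] at hz hz'
        rcases hz with rfl | rfl <;> rcases hz' with rfl | rfl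
        · exact absurd rfl hne
        · exact key _ (by rw [Site.supNorm_sub_comm])
        · exact key _ rfl
        · exact absurd rfl hne
      have h := iicMeasure_real_biInter_openConn_le_oneScale hd1 _ hp hc hQM hR hν (a := ρ + 1) hr hrn hnr {u, v} hS hsep
      rw [hset, hcard] at h
      calc ν.real ((openConn (0 : Site d) u : Set (BondConfig (Site d))) ∩ openConn (0 : Site d) v)
          ≤ B ^ (ρ + 1 + 2) / c ^ 2 * (B ^ (ρ + 1) * oneArmProb d (criticalProbI d) n) ^ 2 := h
        _ = B ^ (3 * (ρ + 1) + 2) / c ^ 2 * oneArmProb d (criticalProbI d) n * oneArmProb d (criticalProbI d) n := by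
            field_simp
            ring
        _ ≤ max C₁ (B ^ (3 * (ρ + 1) + 2) / c ^ 2) * oneArmProb d (criticalProbI d) n * oneArmProb d (criticalProbI d) m :=
            mul_le_mul (mul_le_mul_of_nonneg_right (le_max_right _ _) hπn.le) hmono hπn.le
              (mul_nonneg (hC₁.le.trans (le_max_left _ _)) hπn.le)

/-- **THE PAIR-CONNECTIVITY FORMULA OF KESTEN'S IIC** (`p_c(ℤ^d)`, `d ≥ 2`; (A2)□ at aspect `(s,L)`, `2 ≤ s ≤ L`, `ϰ > 0`; `CU⁺_l(c_U)`,
`l ≥ 2`, `c_U > 0`; UAD; `θ(p_c) = 0` from p205010): there are `n₀ ≥ 1` and `0 < c, C` such that for every IIC probability measure `ν`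
(Kesten's limit property) and all sites `x, y` with `‖x‖_∞, ‖y‖_∞, ‖x − y‖_∞ ≥ n₀`:
**`c·π_{p_c}(min(‖x‖,‖y‖))·π_{p_c}(‖x − y‖) ≤ ν({0 ↔ x} ∩ {0 ↔ y}) ≤ C·π_{p_c}(min(‖x‖,‖y‖))·π_{p_c}(‖x − y‖)`** — equivalently
`ν(x, y ∈ C(0)) ≍ π(d₁)π(d₂)` for the two smallest pairwise distances `d₁ ≤ d₂` of `{0, x, y}`: THE THREE-POINT FUNCTION OF THE IIC IS A TREE.
Proof: for `‖x‖ ≤ ‖y‖` the three cases `‖x − y‖ ≤ ‖x‖` (root `0`, frame `(x, y)`), `‖x‖ < ‖x − y‖ ≤ ‖y‖` (re-root at `y`, frame `(x − y, −y)`)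
and `‖y‖ < ‖x − y‖` (re-root at `y`, frame `(−y, x − y)`, then `π(‖y‖) ≍ π(‖x − y‖)` as `‖y‖ ≤ ‖x − y‖ ≤ 2‖y‖`) of the one-shell frame theorem.
[cite: Kesten1986, Thm. (8)] [cite: BasuSapozhnikov2017ECP, Thm. 1.1 and Remark 2.1] -/
theorem exists_iicMeasure_real_pair_two_sided_criticalProbI (hd : 2 ≤ d) {s L : ℕ} (hs : 2 ≤ s) (hsL : s ≤ L)
    {ϰ : ℝ} (hϰ : 0 < ϰ) (hA2 : SetToSetQuasiMultAspectAt d (criticalProbI d) s L ϰ) {l : ℕ} (hl : 2 ≤ l) {cU : ℝ} (hcU : 0 < cU)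
    (hCU : ∀ a : ℕ, 1 ≤ a → ∀ E : Set (BondConfig (Site d)), IsUpperSet E → MeasurableSet E →
      cU * (bondPercolation (zdGraph d) (criticalProbI d)).real E ≤ (bondPercolation (zdGraph d) (criticalProbI d)).real (E ∩
        {ω : BondConfig (Site d) | ∀ t ∈ innerBoundary (zdGraph d) (box d a), ∀ s ∈ innerBoundary (zdGraph d) (box d (l * a)),
          ∀ t' ∈ innerBoundary (zdGraph d) (box d a), ∀ s' ∈ innerBoundary (zdGraph d) (box d (l * a)),
          ω ∈ openConnIn (↑((box d (l * a) \ box d a) ∪ innerBoundary (zdGraph d) (box d a)) : Set (Site d)) t s →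
          ω ∈ openConnIn (↑((box d (l * a) \ box d a) ∪ innerBoundary (zdGraph d) (box d a)) : Set (Site d)) t' s' →
          ω ∈ openConnIn (↑((box d (l * a) \ box d a) ∪ innerBoundary (zdGraph d) (box d a)) : Set (Site d)) s s'}))
    (hUAD : ∀ ε : ℝ, 0 < ε → ∃ K₀ : ℕ, ∀ m : ℕ, 1 ≤ m → ∀ N : ℕ, K₀ * m ≤ N →
      (bondPercolation (zdGraph d) (criticalProbI d)).real (boxCrossing d m N) ≤ ε) :
    ∃ (n₀ : ℕ) (c C : ℝ), 1 ≤ n₀ ∧ 0 < c ∧ 0 < C ∧ ∀ (ν : Measure (BondConfig (Site d))) [IsProbabilityMeasure ν],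
      (∀ (F : Finset (Sym2 (Site d))) (E : Set (BondConfig (Site d))), MeasurableSet E → DeterminedBy E ↑F →
        Tendsto (fun n : ℕ => (bondPercolation (zdGraph d) (criticalProbI d)).real (E ∩ siteToBoundary d n) /
          oneArmProb d (criticalProbI d) n) atTop (𝓝 (ν.real E))) →
      ∀ x y : Site d, n₀ ≤ Site.supNorm x → n₀ ≤ Site.supNorm y → n₀ ≤ Site.supNorm (x - y) →
        c * oneArmProb d (criticalProbI d) (min (Site.supNorm x) (Site.supNorm y)) *
              oneArmProb d (criticalProbI d) (Site.supNorm (x - y)) ≤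
            ν.real ((openConn (0 : Site d) x : Set (BondConfig (Site d))) ∩ openConn (0 : Site d) y) ∧
          ν.real ((openConn (0 : Site d) x : Set (BondConfig (Site d))) ∩ openConn (0 : Site d) y) ≤
            C * oneArmProb d (criticalProbI d) (min (Site.supNorm x) (Site.supNorm y)) *
              oneArmProb d (criticalProbI d) (Site.supNorm (x - y)) := by
  have hd1 : 1 ≤ d := le_trans (by norm_num) hd
  have hp : 0 < ((criticalProbI d : unitInterval) : ℝ) := by
    rw [coe_criticalProbI]; exact criticalProb_zd_pos d hd1
  have hπ : ∀ m : ℕ, 0 < oneArmProb d (criticalProbI d) m := fun m => oneArmProb_pos hd1 _ hp m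
  have hθ : theta (zdGraph d) 0 (criticalProbI d) = 0 := CSH.percolationContinuity_allDimensions d hd
  obtain ⟨n₀, c, C, hn₀, hc, hC, hF⟩ := exists_iicMeasure_real_pair_two_sided_frame_criticalProbI hd hs hsL hϰ hA2 hl hcU hCU hUAD
  obtain ⟨B, hB, hR⟩ := Rsw3.exists_oneArmProb_ratio_of_setToSetQuasiMultAspectAt hd hs hsL hϰ hA2
  have hB1 : 1 ≤ B := by
    have h := hR 1 1 le_rfl le_rfl (by norm_num)
    have h1 := hπ 1
    by_contra hlt
    have h2 : B * oneArmProb d (criticalProbI d) 1 < 1 * oneArmProb d (criticalProbI d) 1 :=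
      mul_lt_mul_of_pos_right (lt_of_not_ge hlt) h1
    linarith
  have hCB : C ≤ C * B := le_mul_of_one_le_right hC.le hB1
  refine ⟨n₀, c, C * B, hn₀, hc, by positivity, fun ν _ hν x y hx hy hxy => ?_⟩
  have hreroot := fun x' y' : Site d => iicMeasure_real_openConn_inter_openConn_eq_reroot hd1 _ hp hθ hs hϰ hA2 hν x' y'
  wlog hab : Site.supNorm x ≤ Site.supNorm y generalizing x y
  · have h := this y x hy hx (by rwa [Site.supNorm_sub_comm]) (le_of_not_ge hab)
    rw [min_comm, Site.supNorm_sub_comm, Set.inter_comm] at h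
    exact h
  rw [min_eq_left hab]
  have hπa := hπ (Site.supNorm x)
  have hπb := hπ (Site.supNorm y)
  have hπe := hπ (Site.supNorm (x - y))
  have hba : Site.supNorm y ≤ Site.supNorm (x - y) + Site.supNorm x := by
    rw [Site.supNorm_sub_comm]; exact Site.supNorm_le_supNorm_sub_add y x
  have heab : Site.supNorm (x - y) ≤ Site.supNorm x + Site.supNorm y := by
    rw [sub_eq_add_neg, ← Site.supNorm_neg y]; exact Site.supNorm_add_le x (-y)
  rcases le_or_gt (Site.supNorm (x - y)) (Site.supNorm x) with h1 | h1
  · -- root `0`, frame `(x, y)`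
    have h := hF ν hν x y hab (by omega) (by rwa [Site.supNorm_sub_comm]) (by rwa [Site.supNorm_sub_comm])
    rw [Site.supNorm_sub_comm y x] at h
    exact ⟨h.1, h.2.trans (mul_le_mul_of_nonneg_right (mul_le_mul_of_nonneg_right hCB hπa.le) hπe.le)⟩
  · -- re-root at `y`
    rw [Set.inter_comm, hreroot y x]
    rcases le_or_gt (Site.supNorm (x - y)) (Site.supNorm y) with h2 | h2
    · -- frame `(x − y, −y)`
      have hvu : -y - (x - y) = -x := by abel
      have h := hF ν hν (x - y) (-y) (by rwa [Site.supNorm_neg]) (by rw [Site.supNorm_neg]; omega)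
        (by rw [hvu, Site.supNorm_neg]; exact hx) (by rw [hvu, Site.supNorm_neg]; exact h1.le)
      rw [hvu, Site.supNorm_neg, Set.inter_comm] at h
      constructor
      · calc c * oneArmProb d (criticalProbI d) (Site.supNorm x) * oneArmProb d (criticalProbI d) (Site.supNorm (x - y))
            = c * oneArmProb d (criticalProbI d) (Site.supNorm (x - y)) * oneArmProb d (criticalProbI d) (Site.supNorm x) := by ring
          _ ≤ _ := h.1
      · calc ν.real ((openConn (0 : Site d) (-y) : Set (BondConfig (Site d))) ∩ openConn (0 : Site d) (x - y))
            ≤ C * oneArmProb d (criticalProbI d) (Site.supNorm (x - y)) * oneArmProb d (criticalProbI d) (Site.supNorm x) := h.2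
          _ = C * oneArmProb d (criticalProbI d) (Site.supNorm x) * oneArmProb d (criticalProbI d) (Site.supNorm (x - y)) := by ring
          _ ≤ C * B * oneArmProb d (criticalProbI d) (Site.supNorm x) * oneArmProb d (criticalProbI d) (Site.supNorm (x - y)) :=
              mul_le_mul_of_nonneg_right (mul_le_mul_of_nonneg_right hCB hπa.le) hπe.le
    · -- frame `(−y, x − y)`
      have hvu : x - y - -y = x := by abel
      have h := hF ν hν (-y) (x - y) (by rw [Site.supNorm_neg]; exact h2.le) (by rw [Site.supNorm_neg]; omega)
        (by rw [hvu]; exact hx) (by rw [hvu, Site.supNorm_neg]; exact hab)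
      rw [hvu, Site.supNorm_neg] at h
      have hmono : oneArmProb d (criticalProbI d) (Site.supNorm (x - y)) ≤ oneArmProb d (criticalProbI d) (Site.supNorm y) :=
        real_siteToBoundary_antitone _ h2.le
      have hratio : oneArmProb d (criticalProbI d) (Site.supNorm y) ≤ B * oneArmProb d (criticalProbI d) (Site.supNorm (x - y)) :=
        hR _ _ (le_trans hn₀ hy) h2.le (by omega)
      constructor
      · calc c * oneArmProb d (criticalProbI d) (Site.supNorm x) * oneArmProb d (criticalProbI d) (Site.supNorm (x - y))
            ≤ c * oneArmProb d (criticalProbI d) (Site.supNorm x) * oneArmProb d (criticalProbI d) (Site.supNorm y) :=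
              mul_le_mul_of_nonneg_left hmono (mul_nonneg hc.le hπa.le)
          _ = c * oneArmProb d (criticalProbI d) (Site.supNorm y) * oneArmProb d (criticalProbI d) (Site.supNorm x) := by ring
          _ ≤ _ := h.1
      · calc ν.real ((openConn (0 : Site d) (-y) : Set (BondConfig (Site d))) ∩ openConn (0 : Site d) (x - y))
            ≤ C * oneArmProb d (criticalProbI d) (Site.supNorm y) * oneArmProb d (criticalProbI d) (Site.supNorm x) := h.2
          _ ≤ C * (B * oneArmProb d (criticalProbI d) (Site.supNorm (x - y))) * oneArmProb d (criticalProbI d) (Site.supNorm x) :=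
              mul_le_mul_of_nonneg_right (mul_le_mul_of_nonneg_left hratio hC.le) hπa.le
          _ = C * B * oneArmProb d (criticalProbI d) (Site.supNorm x) * oneArmProb d (criticalProbI d) (Site.supNorm (x - y)) := by
              ring

/-- **THE PAIR FORMULA, ORDERED FORM**: with the hypotheses of `exists_iicMeasure_real_pair_two_sided_criticalProbI`, for the NEARER site `x`
(`‖x‖ ≤ ‖y‖`) the formula reads **`c·π_{p_c}(‖x‖)·π_{p_c}(‖x − y‖) ≤ ν({0 ↔ x} ∩ {0 ↔ y}) ≤ C·π_{p_c}(‖x‖)·π_{p_c}(‖x − y‖)`** (`min = ‖x‖`).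
[cite: Kesten1986, Thm. (8)] [cite: BasuSapozhnikov2017ECP, Thm. 1.1 and Remark 2.1] -/
theorem exists_iicMeasure_real_pair_two_sided_of_le_criticalProbI (hd : 2 ≤ d) {s L : ℕ} (hs : 2 ≤ s) (hsL : s ≤ L)
    {ϰ : ℝ} (hϰ : 0 < ϰ) (hA2 : SetToSetQuasiMultAspectAt d (criticalProbI d) s L ϰ) {l : ℕ} (hl : 2 ≤ l) {cU : ℝ} (hcU : 0 < cU)
    (hCU : ∀ a : ℕ, 1 ≤ a → ∀ E : Set (BondConfig (Site d)), IsUpperSet E → MeasurableSet E →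
      cU * (bondPercolation (zdGraph d) (criticalProbI d)).real E ≤ (bondPercolation (zdGraph d) (criticalProbI d)).real (E ∩
        {ω : BondConfig (Site d) | ∀ t ∈ innerBoundary (zdGraph d) (box d a), ∀ s ∈ innerBoundary (zdGraph d) (box d (l * a)),
          ∀ t' ∈ innerBoundary (zdGraph d) (box d a), ∀ s' ∈ innerBoundary (zdGraph d) (box d (l * a)),
          ω ∈ openConnIn (↑((box d (l * a) \ box d a) ∪ innerBoundary (zdGraph d) (box d a)) : Set (Site d)) t s →
          ω ∈ openConnIn (↑((box d (l * a) \ box d a) ∪ innerBoundary (zdGraph d) (box d a)) : Set (Site d)) t' s' →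
          ω ∈ openConnIn (↑((box d (l * a) \ box d a) ∪ innerBoundary (zdGraph d) (box d a)) : Set (Site d)) s s'}))
    (hUAD : ∀ ε : ℝ, 0 < ε → ∃ K₀ : ℕ, ∀ m : ℕ, 1 ≤ m → ∀ N : ℕ, K₀ * m ≤ N →
      (bondPercolation (zdGraph d) (criticalProbI d)).real (boxCrossing d m N) ≤ ε) :
    ∃ (n₀ : ℕ) (c C : ℝ), 1 ≤ n₀ ∧ 0 < c ∧ 0 < C ∧ ∀ (ν : Measure (BondConfig (Site d))) [IsProbabilityMeasure ν],
      (∀ (F : Finset (Sym2 (Site d))) (E : Set (BondConfig (Site d))), MeasurableSet E → DeterminedBy E ↑F →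
        Tendsto (fun n : ℕ => (bondPercolation (zdGraph d) (criticalProbI d)).real (E ∩ siteToBoundary d n) /
          oneArmProb d (criticalProbI d) n) atTop (𝓝 (ν.real E))) →
      ∀ x y : Site d, n₀ ≤ Site.supNorm x → Site.supNorm x ≤ Site.supNorm y → n₀ ≤ Site.supNorm (x - y) →
        c * oneArmProb d (criticalProbI d) (Site.supNorm x) * oneArmProb d (criticalProbI d) (Site.supNorm (x - y)) ≤
            ν.real ((openConn (0 : Site d) x : Set (BondConfig (Site d))) ∩ openConn (0 : Site d) y) ∧
          ν.real ((openConn (0 : Site d) x : Set (BondConfig (Site d))) ∩ openConn (0 : Site d) y) ≤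
            C * oneArmProb d (criticalProbI d) (Site.supNorm x) * oneArmProb d (criticalProbI d) (Site.supNorm (x - y)) := by
  obtain ⟨n₀, c, C, hn₀, hc, hC, h⟩ := exists_iicMeasure_real_pair_two_sided_criticalProbI hd hs hsL hϰ hA2 hl hcU hCU hUAD
  refine ⟨n₀, c, C, hn₀, hc, hC, fun ν _ hν x y hx hxy hxy' => ?_⟩
  have h' := h ν hν x y hx (hx.trans hxy) hxy'
  rwa [min_eq_left hxy] at h'

end Summit.CriticalPhenomena.PercolationContinuityZ3.Theorems.Crossing

end
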